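import Summits.QuantumFields.BalabanUV.Beta.EriceRemainderEnclosureHistoryAutonomyComparisonAdvantage
import Summits.QuantumFields.BalabanUV.Beta.EriceRemainderEnclosureHistoryAutonomyComparisonBarrierShift

/-!
# EriceRemainderEnclosureHistoryAutonomyComparisonAdvantageLead — (E61f) THE LEAD IN SCALES GROWS LINEARLY: for ISOTONE memory with zeroth moment `M`,
# floor `b > 0` and `M·γ ≤ 3√3·b`, raising the floor by `ε > 0` puts the perturbed trajectory `s` FULL SCALES ahead of the base trajectory
# (`h′_n ≤ h_{n+s}`) at every scale `n ≥ m` as soon as `(1 − M·p∕(3√3·b))·e^{−M·p∕b}·m·ε ≥ s·U`, `U = B(γ,…,γ) + M·γ` the box bound of the increments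
# — (E61e)'s linear advantage converted into (E61b)'s integer lead, which then never shrinks (`lead_from_advantage`, `scales_ahead`)

Cell `pub-balaban`, β-function sub-cell, BINDER row D4 «RemainderConst leaves for Bałaban's split» (`HOME/BINDER-OWNERS.md`; owner lineage `b2b-balaban-beta-an4`;
this file by co-owner #2 lineage `b2b-balaban-beta-d4-p2`, generation 54), β-FLOW TEAM duty (1), FREEZE (0) honoured (def-free; (E61e)'s `advantage_ge_linear`,
(E61b)'s `lead_mono_all`, (E49k)'s `effective_le_all`, (E48a)'s `family_mem` ∕ `le_upper_of_zm`, node U2's `invSq_eq_of_memFlow` ∕ `drive`, (E39), (E43b) BY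
NAME; nothing restated).  Sequel of (E61b) `…ComparisonBarrierShift` («once `s` scales ahead, always») and (E61e) `…ComparisonAdvantage` (the advantage
`1∕h′_m² − 1∕h_m²` grows linearly).

HONEST FRAMING (page 1, verbatim and binding).  *"Discharging BetaPertH makes Bałaban's UV stability UNCONDITIONAL — a real constructive-QFT result; it is
NOT the continuum limit and NOT the Clay problem."*  THIS FILE DISCHARGES NOTHING OF THE KIND.  Elementary real analysis about ABSTRACT functionals on a box
]0,γ]^ℕ with displayed floors, moduli and signs — hypotheses of a census, not facts; the form, signs and moments of Bałaban's (1.22) limit functional are NOT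
PRINTED ([I] p. 298; GAPS G-t4-U2-1∕-2) and NOT asserted.  Row D4 class UNCHANGED (critical-path width 0; instance 0∕1; D4 DISCHARGE NO DATE).  HONEST
DEPENDENCY: continuum YM on T⁴ ⇐ BetaPertH ∧ nine spine estimates (0/9 proved); BetaPertH ⇐ (D1) ∧ (D4) ∧ CAP+tail; G-an2-4 gates asym, D1 and NE2/3/4.

THE POINT (census sense (α); the COMPARISON column of the autonomy row).  The increments of the base recursion variable are bounded on the box,
`1∕h_{n+1}² − 1∕h_n² = B(h(n+1+·)) ≤ U := B(γ,…,γ) + M·γ`, so `1∕h_{m+s}² ≤ 1∕h_m² + s·U`; and by (E61e) the advantage is `1∕h′_m² − 1∕h_m² ≥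
κ·e^{−Λ}·m·ε` (`κ = 1 − M·p∕(3√3·b)`, `Λ = M·p∕b`).  Hence `h′_m ≤ h_{m+s}` as soon as `κ·e^{−Λ}·m·ε ≥ s·U` (§1 `lead_from_advantage`), and by (E61b)
`lead_mono_all` the lead persists at every later scale (§2 **`scales_ahead`**, family-free): the time shift of the lineage's numerics grows at least like
`⌊κ e^{−Λ} ε·n ∕ U⌋` scales — the first two-sided picture «between `s` scales ahead and `s` scales + `n·ε`» of an ordered pair at or below the threshold.
NOT CLAIMED: the sharp rate; anything above the threshold; anything printed.

WHAT IS PROVED ([folklore]; 0 `def`, 0 sorry).  §1 `level_window_le`, **`lead_from_advantage`**.  §2 **`scales_ahead`**.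
-/
noncomputable section
open Finset Set

namespace Summit.QuantumFields.BalabanUV.Beta.EriceRemainderEnclosureHistoryAutonomyComparisonAdvantageLead

open Literature.MathematicalPhysics.QuantumFieldTheory.Balaban1983to89
open Literature.MathematicalPhysics.QuantumFieldTheory.Balaban1983to89.T4BetaStationary
open Literature.MathematicalPhysics.QuantumFieldTheory.Balaban1983to89.T4BetaFlowWellPosed
open Summit.QuantumFields.BalabanUV.Beta.EriceRemainderEnclosureHistoryAutonomyThreshold (three_sqrt_three_pos)
open Summit.QuantumFields.BalabanUV.Beta.EriceRemainderEnclosureHistoryAutonomyOrder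
open Summit.QuantumFields.BalabanUV.Beta.EriceRemainderEnclosureHistoryAutonomyComparisonIsotoneExcess (effective_le_all)
open Summit.QuantumFields.BalabanUV.Beta.EriceRemainderEnclosureHistoryAutonomyComparisonAdvantage (advantage_ge_linear)
open Summit.QuantumFields.BalabanUV.Beta.EriceRemainderEnclosureHistoryAutonomyComparisonBarrierShift (lead_mono_all)
open Summit.QuantumFields.BalabanUV.Beta.EriceRemainderEnclosureHistoryAutonomyExistence (exists_memFlow_zm)
open Summit.QuantumFields.BalabanUV.Beta.EriceRemainderEnclosureHistoryAutonomyMonotoneGeneral (memFlow_unique_of_monotone_zm)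

variable {B : (ℕ → ℝ) → ℝ} {M γ b y ε : ℝ} {h h' : ℕ → ℝ} {S S' : ℝ → ℕ → ℝ}

/-! ## §1 A window of `s` scales costs at most `s·U` in the recursion variable; the advantage buys the lead -/

/-- **A WINDOW OF `s` SCALES COSTS AT MOST `s·U`**: along a box solution `u` of `B` (zeroth moment `M ≥ 0` on ]0,γ]), `1∕u_{m+s}² ≤ 1∕u_m² + s·U` with
`U = B(γ,…,γ) + M·γ` ((E48a) `le_upper_of_zm` on each increment). [folklore] -/
theorem level_window_le
    (hB : ∀ u u' : ℕ → ℝ, SeqBox γ u → SeqBox γ u' → ∀ D : ℝ, (∀ j, |u j - u' j| ≤ D) → |B u - B u'| ≤ M * D) (hγ : 0 < γ)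
    {u : ℕ → ℝ} (hu : SeqBox γ u) (hf : MemFlow B y u) (m : ℕ) : ∀ s : ℕ,
    1 / u (m + s) ^ 2 ≤ 1 / u m ^ 2 + (s : ℝ) * (B (fun _ => γ) + M * γ)
  | 0 => by simp
  | s + 1 => by
    have ih := level_window_le hB hγ hu hf m s
    have e := hf.2 (m + s)
    rw [show m + (s + 1) = m + s + 1 by omega, e, Nat.cast_succ]
    have := le_upper_of_zm hB hγ _ (seqBox_shift hu (m + s + 1))
    linarith

/-- **THE ADVANTAGE BUYS THE LEAD.**  `B` ISOTONE with zeroth moment `M ≥ 0`, floor `b > 0`, `M·γ ≤ 3√3·b`; `ε ≥ 0`; unique solution families `S`, `S′` of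
`B`, `B + ε`; a pin `y ∈ ]0,γ]`, `s, m ∈ ℕ` with `s·(B(γ,…,γ) + M·γ) ≤ (1 − M·y∕(3√3·b))·e^{−M·y∕b}·m·ε`.  Then `S′ y m ≤ S y (m+s)`: at scale `m` the
perturbed trajectory is `s` full scales ahead ((E61e) `advantage_ge_linear` against `level_window_le`). [folklore] -/
theorem lead_from_advantage (hmono : ∀ u v : ℕ → ℝ, SeqBox γ u → SeqBox γ v → (∀ j, u j ≤ v j) → B u ≤ B v)
    (hB : ∀ u u' : ℕ → ℝ, SeqBox γ u → SeqBox γ u' → ∀ D : ℝ, (∀ j, |u j - u' j| ≤ D) → |B u - B u'| ≤ M * D)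
    (hM : 0 ≤ M) (hγ : 0 < γ) (hb : 0 < b) (hlo : ∀ u, SeqBox γ u → b ≤ B u) (hsmall : M * γ ≤ 3 * Real.sqrt 3 * b) (hε : 0 ≤ ε)
    (hS : ∀ p, 0 < p → p ≤ γ → SeqBox γ (S p) ∧ MemFlow B p (S p))
    (huniq : ∀ p, 0 < p → p ≤ γ → ∀ u u' : ℕ → ℝ, SeqBox γ u → SeqBox γ u' → MemFlow B p u → MemFlow B p u' → u = u')
    (hS' : ∀ p, 0 < p → p ≤ γ → SeqBox γ (S' p) ∧ MemFlow (fun v => B v + ε) p (S' p))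
    (huniq' : ∀ p, 0 < p → p ≤ γ → ∀ u u' : ℕ → ℝ, SeqBox γ u → SeqBox γ u' →
      MemFlow (fun v => B v + ε) p u → MemFlow (fun v => B v + ε) p u' → u = u')
    (hy : 0 < y) (hyγ : y ≤ γ) {s m : ℕ}
    (hbuy : (s : ℝ) * (B (fun _ => γ) + M * γ) ≤ (1 - M * y / (3 * Real.sqrt 3 * b)) * Real.exp (-(M * y / b)) * (m : ℝ) * ε) :
    S' y m ≤ S y (m + s) := by
  have hadv := advantage_ge_linear hmono hB hM hγ hb hlo hsmall hε hS huniq hS' huniq' hy hyγ m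
  have hwin := level_window_le hB hγ (hS y hy hyγ).1 (hS y hy hyγ).2 m s
  have hpos := (family_mem hS hy hyγ (m + s)).1
  have hpos' := (family_mem hS' hy hyγ m).1
  -- 1/(S y (m+s))² ≤ 1/(S′ y m)²
  have hlev : 1 / S y (m + s) ^ 2 ≤ 1 / S' y m ^ 2 := by linarith
  by_contra hlt
  rw [not_le] at hlt
  have : 1 / S' y m ^ 2 < 1 / S y (m + s) ^ 2 :=
    one_div_lt_one_div_of_lt (pow_pos hpos 2) (pow_lt_pow_left₀ hlt hpos.le two_ne_zero)
  linarith

/-! ## §2 END: the perturbed trajectory is `s` scales ahead from scale `m` on -/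

/-- **THE LEAD IN SCALES GROWS LINEARLY.**  `B` ISOTONE on ]0,γ] with zeroth moment `M ≥ 0`, floor `b > 0` and `M·γ ≤ 3√3·b`; `ε ≥ 0`; `h`, `h′` ANY box
solutions of `B` and `B + ε` from one pin `p ∈ ]0,γ]`.  If `s·(B(γ,…,γ) + M·γ) ≤ (1 − M·p∕(3√3·b))·e^{−M·p∕b}·m·ε` then `h′_n ≤ h_{n+s}` for EVERY
`n ≥ m`: the raised floor puts the running coupling `s` full scales ahead from scale `m` on — §1 at scale `m`, then (E61b) `lead_mono_all` (order of the
effective β-functions everywhere by (E49k)). [folklore] -/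
theorem scales_ahead {p : ℝ} (hmono : ∀ u v : ℕ → ℝ, SeqBox γ u → SeqBox γ v → (∀ j, u j ≤ v j) → B u ≤ B v)
    (hB : ∀ u u' : ℕ → ℝ, SeqBox γ u → SeqBox γ u' → ∀ D : ℝ, (∀ j, |u j - u' j| ≤ D) → |B u - B u'| ≤ M * D)
    (hM : 0 ≤ M) (hb : 0 < b) (hlo : ∀ u, SeqBox γ u → b ≤ B u) (hsmall : M * γ ≤ 3 * Real.sqrt 3 * b) (hε : 0 ≤ ε)
    (hp : 0 < p) (hpγ : p ≤ γ) (hh : SeqBox γ h) (hf : MemFlow B p h) (hh' : SeqBox γ h')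
    (hf' : MemFlow (fun v => B v + ε) p h') {s m : ℕ}
    (hbuy : (s : ℝ) * (B (fun _ => γ) + M * γ) ≤ (1 - M * p / (3 * Real.sqrt 3 * b)) * Real.exp (-(M * p / b)) * (m : ℝ) * ε)
    {n : ℕ} (hn : m ≤ n) : h' n ≤ h (n + s) := by
  have hγ : 0 < γ := hp.trans_le hpγ
  have hmono' : ∀ u v : ℕ → ℝ, SeqBox γ u → SeqBox γ v → (∀ j, u j ≤ v j) → (fun w => B w + ε) u ≤ (fun w => B w + ε) v :=
    fun u v hu hv huv => by simpa using hmono u v hu hv huv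
  have hB' : ∀ u u' : ℕ → ℝ, SeqBox γ u → SeqBox γ u' → ∀ D : ℝ, (∀ j, |u j - u' j| ≤ D) →
      |(fun w => B w + ε) u - (fun w => B w + ε) u'| ≤ M * D := fun u u' hu hu' D hD => by simpa using hB u u' hu hu' D hD
  have hlo' : ∀ u, SeqBox γ u → b ≤ (fun w => B w + ε) u := fun u hu => by simpa using (hlo u hu).trans (le_add_of_nonneg_right hε)
  have hexc : ∀ u, SeqBox γ u → B u ≤ (fun v => B v + ε) u := fun u _ => by simpa using hε
  have hDmono : ∀ u v : ℕ → ℝ, SeqBox γ u → SeqBox γ v → (∀ j, u j ≤ v j) →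
      (fun w => B w + ε) u - B u ≤ (fun w => B w + ε) v - B v := fun u v _ _ _ => by simp
  -- the two solution families
  have hex : ∀ q : ℝ, 0 < q → q ≤ γ → ∃ k : ℕ → ℝ, SeqBox γ k ∧ MemFlow B q k := fun q hq hqγ => exists_memFlow_zm hB hM hq hqγ hb hlo
  have hex' : ∀ q : ℝ, 0 < q → q ≤ γ → ∃ k : ℕ → ℝ, SeqBox γ k ∧ MemFlow (fun w => B w + ε) q k :=
    fun q hq hqγ => exists_memFlow_zm hB' hM hq hqγ hb hlo'
  choose! S hSb hSf using hex
  choose! S' hS'b hS'f using hex'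
  have hS : ∀ q, 0 < q → q ≤ γ → SeqBox γ (S q) ∧ MemFlow B q (S q) := fun q hq hqγ => ⟨hSb q hq hqγ, hSf q hq hqγ⟩
  have hS' : ∀ q, 0 < q → q ≤ γ → SeqBox γ (S' q) ∧ MemFlow (fun w => B w + ε) q (S' q) :=
    fun q hq hqγ => ⟨hS'b q hq hqγ, hS'f q hq hqγ⟩
  have huniq : ∀ q, 0 < q → q ≤ γ → ∀ u u' : ℕ → ℝ, SeqBox γ u → SeqBox γ u' → MemFlow B q u → MemFlow B q u' → u = u' :=
    fun q hq _ u u' hu hu' hfu hfu' => memFlow_unique_of_monotone_zm hmono hB hM hq hb hlo hu hu' hfu hfu'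
  have huniq' : ∀ q, 0 < q → q ≤ γ → ∀ u u' : ℕ → ℝ, SeqBox γ u → SeqBox γ u' →
      MemFlow (fun w => B w + ε) q u → MemFlow (fun w => B w + ε) q u' → u = u' :=
    fun q hq _ u u' hu hu' hfu hfu' => memFlow_unique_of_monotone_zm hmono' hB' hM hq hb hlo' hu hu' hfu hfu'
  have e : h = S p := huniq p hp hpγ _ _ hh (hS p hp hpγ).1 hf (hS p hp hpγ).2
  have e' : h' = S' p := huniq' p hp hpγ _ _ hh' (hS' p hp hpγ).1 hf' (hS' p hp hpγ).2
  rw [e, e']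
  -- order of the effective β-functions at every pin ((E49k)), the lead at scale m (§1), then it never shrinks ((E61b))
  have horder : ∀ z, 0 < z → z ≤ γ → B (S z) ≤ (fun w => B w + ε) (S' z) :=
    effective_le_all hmono hB hM hγ hb hlo hsmall hexc hDmono hb hB' hM hlo' hS huniq hS' huniq'
  have hlead : S' p m ≤ S p (m + s) :=
    lead_from_advantage hmono hB hM hγ hb hlo hsmall hε hS huniq hS' huniq' hp hpγ hbuy
  exact lead_mono_all hmono hγ hb hB hM hlo hS huniq hS' huniq' horder hp hpγ hlead hn

end Summit.QuantumFields.BalabanUV.Beta.EriceRemainderEnclosureHistoryAutonomyComparisonAdvantageLead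

end
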